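import Mathlib
import Literature.Analysis.FluidPDE.GaussianVortexPlanar
import Literature.Analysis.FluidPDE.GaussianVortexPlanarProofs
import Literature.Analysis.FluidPDE.BiotSavart2DSymmetry
import Summits.AnomalousDissipation.AnomalousDissipation.Theorems.MarginalStabilityChainStretchedVortexRowsStubCoreRotationLocalSkew
import Summits.AnomalousDissipation.AnomalousDissipation.Theorems.MarginalStabilityChainStretchedVortexRowsStubBiotSavartFarField
import Summits.AnomalousDissipation.AnomalousDissipation.Theorems.MarginalStabilityChainStretchedVortexRowsStubBiotSavartYoung
import Summits.AnomalousDissipation.AnomalousDissipation.Theorems.MarginalStabilityChainStretchedVortexRowsStubCoreLEnergyGapYControl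
import Summits.AnomalousDissipation.AnomalousDissipation.Theorems.MarginalStabilityChainStretchedVortexRowsStubCellSolvabilityRadialWeights
import HarnessLib

/-!
# Helper `lamB_pairing_dtheta_bound` toward stub `stub_coreInverse` of the line `braid-closed-large-circulation-gluing`
# (crux stmt-AnomalousDissipation-3009, `MarginalStabilityChain.StretchedVortexRows`)

The pairing of the linearised Biot–Savart coupling to the background correction `w_B` of the strained Gaussian
core, `Λ_B w = (K∗w)·∇w_B + (K∗w_B)·∇w` (`K(z) = z^⊥/(2π|z|²)`), against the angular derivative `∂_θw = Dw[ξ^⊥]`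
in `X = L²(G⁻¹)`, `G = (4π)⁻¹e^{−|ξ|²/4}`:  `|⟨Λ_B w, ∂_θw⟩_X| ≤ C₄(k, C_B) ‖w‖_Y Θ^{1/2}`,
`‖w‖²_Y = ∫ G⁻¹(w² + |∇w|²)`, `Θ = ∫ G⁻¹ Ω (∂_θw)²`, `Ω(ξ) = (8π)⁻¹ φ(|ξ|²/4)`, for `w = G u` (`u ∈ C²`,
`u, Du, D²u` bounded) and `|w_B| + |∇w_B| ≤ C_B (1+|ξ|)^k G`. No symmetry is used: both pieces
`X₁ = ⟪K∗w, ∇w_B⟫`, `X₂ = ⟪K∗w_B, ∇w⟫` are estimated by the weighted Cauchy–Schwarz inequality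
`|∫ G⁻¹ X ∂_θw| ≤ (∫ P)^{1/2} Θ^{1/2}` whenever `G⁻¹ X² ≤ P Ω` pointwise, with the lower bound
`Ω⁻¹ ≤ 8π (1 + |ξ|²/4) ≤ 8π (1+|ξ|)²` (`φ(t) ≥ 1/(1+t)`, landed `inv_one_add_le_burgersPhi`):
(`X₂`) the far field `‖K∗w_B(ξ)‖ ≤ C_k C_B/(1+|ξ|)` (landed `biotSavart2D_farField`) gives
`P₂ = 8π C_k²C_B² G⁻¹(w² + |∇w|²)`, `∫ P₂ = 8πC_k²C_B² ‖w‖²_Y`; (`X₁`) `|∇w_B| ≤ C_B(1+|ξ|)^k G` gives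
`P₁ = ‖K∗w‖² h²` with the bounded square-integrable Gaussian weight `h² = 8π C_B² (1+|ξ|)^{2k+2} G`, and the
Young-type bound `∫ ‖K∗w‖² h² ≤ C (H² ∫ w² + ‖w‖₁² ∫ h²)` (landed `biotSavart2D_mul_sq_integral_le`) with
`∫ w² ≤ (4π)⁻¹ ‖w‖²_X` (`G ≤ (4π)⁻¹`), `‖w‖₁² ≤ (∫ G) ‖w‖²_X = ‖w‖²_X` (Cauchy–Schwarz) gives `∫ P₁ ≤ C' ‖w‖²_Y`.
All integrals are genuine: `w = G u ∈ Y` (landed `memGWSobolev_gaussVortexProfile_mul`), `∂_θ(Gu) = G ∂_θu` with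
`|∂_θu| ≤ M|ξ|`, so `G⁻¹Ω(∂_θw)² ≤ (8π)⁻¹M²|ξ|²G ∈ L¹`, and each pairing is dominated by `(P_i + G⁻¹Ω(∂_θw)²)/2`.

References: Th. Gallay, C. E. Wayne, Comm. Math. Phys. 255 (2005) §4 and J. Math. Fluid Mech. 9 (2007) §1–2
(the spaces `X`, `Y`, the operator `Λ`); the estimates themselves are elementary (folklore).
-/

set_option linter.dupNamespace false

noncomputable section

open scoped RealInnerProductSpace Topology ContDiff
open MeasureTheory WithLp Function Metric Filter Set

namespace Summit.AnomalousDissipation.AnomalousDissipation.Theorems.MarginalStabilityChainStretchedVortexRows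

open Literature.Analysis.FluidPDE

/-! ### Elementary tools -/

/-- **Lower bound of the angular velocity of the Gaussian vortex**: `1 ≤ 8π (1+|ξ|)² Ω(ξ)` for
`Ω(ξ) = (8π)⁻¹ φ(|ξ|²/4)` (from `φ(t) ≥ 1/(1+t)` and `1 + |ξ|²/4 ≤ (1+|ξ|)²`). [folklore] -/
theorem one_le_mul_sq_mul_omegaWeight (ξ : EuclideanSpace ℝ (Fin 2)) :
    1 ≤ 8 * Real.pi * (1 + ‖ξ‖) ^ 2 * ((8 * Real.pi)⁻¹ * burgersPhi (‖ξ‖ ^ 2 / 4)) := by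
  have ht : 0 ≤ ‖ξ‖ ^ 2 / 4 := by positivity
  have hφ := inv_one_add_le_burgersPhi ht
  have hφ0 := burgersPhi_pos (‖ξ‖ ^ 2 / 4)
  have ht1 : 0 < 1 + ‖ξ‖ ^ 2 / 4 := by positivity
  have h1 : 1 ≤ (1 + ‖ξ‖ ^ 2 / 4) * burgersPhi (‖ξ‖ ^ 2 / 4) := by
    calc (1 : ℝ) = (1 + ‖ξ‖ ^ 2 / 4) * (1 + ‖ξ‖ ^ 2 / 4)⁻¹ := (mul_inv_cancel₀ ht1.ne').symm
      _ ≤ (1 + ‖ξ‖ ^ 2 / 4) * burgersPhi (‖ξ‖ ^ 2 / 4) := mul_le_mul_of_nonneg_left hφ ht1.le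
  have h2 : 1 + ‖ξ‖ ^ 2 / 4 ≤ (1 + ‖ξ‖) ^ 2 := by nlinarith [norm_nonneg ξ]
  have hpi : 8 * Real.pi * (1 + ‖ξ‖) ^ 2 * ((8 * Real.pi)⁻¹ * burgersPhi (‖ξ‖ ^ 2 / 4)) =
      (1 + ‖ξ‖) ^ 2 * burgersPhi (‖ξ‖ ^ 2 / 4) := by
    field_simp
  rw [hpi]
  exact h1.trans (mul_le_mul_of_nonneg_right h2 hφ0.le)

/-- The arithmetic of the weighted Cauchy–Schwarz splitting: if `g X² ≤ P o` with `g ≥ 0`, then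
`(g X d)² ≤ P (g o d²)`. [folklore] -/
theorem sq_weightedPairing_le {g X d P o : ℝ} (hg : 0 ≤ g) (h : g * X ^ 2 ≤ P * o) :
    (g * X * d) ^ 2 ≤ P * (g * o * d ^ 2) := by
  calc (g * X * d) ^ 2 = g * X ^ 2 * (g * d ^ 2) := by ring
    _ ≤ P * o * (g * d ^ 2) := mul_le_mul_of_nonneg_right h (mul_nonneg hg (sq_nonneg d))
    _ = P * (g * o * d ^ 2) := by ring

/-- **Cauchy–Schwarz for real integrals, domination form**: if `r² ≤ p q` pointwise with `p, q ≥ 0`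
integrable and `r` measurable, then `r` is integrable and `|∫ r| ≤ (∫ p)^{1/2} (∫ q)^{1/2}`
(`|r| ≤ √p √q ≤ (p + q)/2` and Hölder with exponents `2, 2`). [folklore] -/
theorem integrable_and_abs_integral_le_of_sq_le_mul {r p q : EuclideanSpace ℝ (Fin 2) → ℝ}
    (hr : AEStronglyMeasurable r volume) (hp : Integrable p) (hq : Integrable q)
    (hp0 : ∀ x, 0 ≤ p x) (hq0 : ∀ x, 0 ≤ q x) (hle : ∀ x, r x ^ 2 ≤ p x * q x) :
    Integrable r ∧ |∫ x, r x| ≤ Real.sqrt (∫ x, p x) * Real.sqrt (∫ x, q x) := by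
  have hpt : ∀ x, |r x| ≤ Real.sqrt (p x) * Real.sqrt (q x) := fun x => by
    rw [← Real.sqrt_mul (hp0 x)]
    exact Real.abs_le_sqrt (hle x)
  have hag : ∀ x, Real.sqrt (p x) * Real.sqrt (q x) ≤ (p x + q x) / 2 := fun x => by
    nlinarith [sq_nonneg (Real.sqrt (p x) - Real.sqrt (q x)), Real.sq_sqrt (hp0 x), Real.sq_sqrt (hq0 x)]
  have hsp : AEStronglyMeasurable (fun x => Real.sqrt (p x)) volume :=
    Real.continuous_sqrt.comp_aestronglyMeasurable hp.aestronglyMeasurable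
  have hsq : AEStronglyMeasurable (fun x => Real.sqrt (q x)) volume :=
    Real.continuous_sqrt.comp_aestronglyMeasurable hq.aestronglyMeasurable
  have hbi : Integrable fun x => (p x + q x) / 2 := (hp.add hq).div_const 2
  have hri : Integrable r :=
    hbi.mono' hr (Eventually.of_forall fun x => by
      rw [Real.norm_eq_abs]
      exact (hpt x).trans (hag x))
  have hfgi : Integrable fun x => Real.sqrt (p x) * Real.sqrt (q x) :=
    hbi.mono' (hsp.mul hsq) (Eventually.of_forall fun x => by
      rw [Real.norm_of_nonneg (mul_nonneg (Real.sqrt_nonneg _) (Real.sqrt_nonneg _))]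
      exact hag x)
  have hf : MemLp (fun x => Real.sqrt (p x)) (ENNReal.ofReal 2) volume := by
    rw [ENNReal.ofReal_ofNat, memLp_two_iff_integrable_sq hsp]
    simp_rw [Real.sq_sqrt (hp0 _)]
    exact hp
  have hg : MemLp (fun x => Real.sqrt (q x)) (ENNReal.ofReal 2) volume := by
    rw [ENNReal.ofReal_ofNat, memLp_two_iff_integrable_sq hsq]
    simp_rw [Real.sq_sqrt (hq0 _)]
    exact hq
  have hCS := integral_mul_le_Lp_mul_Lq_of_nonneg Real.HolderConjugate.two_two
    (Eventually.of_forall fun x => Real.sqrt_nonneg (p x))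
    (Eventually.of_forall fun x => Real.sqrt_nonneg (q x)) hf hg
  have h2 : ∀ x, Real.sqrt (p x) ^ (2 : ℝ) = p x := fun x => by
    rw [Real.rpow_two, Real.sq_sqrt (hp0 x)]
  have h3 : ∀ x, Real.sqrt (q x) ^ (2 : ℝ) = q x := fun x => by
    rw [Real.rpow_two, Real.sq_sqrt (hq0 x)]
  simp_rw [h2, h3, ← Real.sqrt_eq_rpow] at hCS
  refine ⟨hri, ?_⟩
  calc |∫ x, r x| ≤ ∫ x, |r x| := abs_integral_le_integral_abs
    _ ≤ ∫ x, Real.sqrt (p x) * Real.sqrt (q x) := integral_mono hri.abs hfgi hpt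
    _ ≤ Real.sqrt (∫ x, p x) * Real.sqrt (∫ x, q x) := hCS

/-! ### The class `Y = {w : G⁻¹(w² + |∇w|²) ∈ L¹}` and the rotation form `Θ` -/

/-- **`Y ⊂ L¹ ∩ L²` quantitatively**: if `G⁻¹(w² + |∇w|²) ∈ L¹` for a continuous `w`, then `w ∈ L¹ ∩ L²` with
`∫ w² ≤ (4π)⁻¹ ‖w‖²_Y` (`G ≤ (4π)⁻¹`) and `‖w‖₁² ≤ (∫ G) ‖w‖²_Y = ‖w‖²_Y` (Cauchy–Schwarz). [folklore] -/
theorem integrable_and_sq_le_of_gwSobolev {w : EuclideanSpace ℝ (Fin 2) → ℝ} (hw : Continuous w)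
    (hS : Integrable fun ξ => (gaussVortexProfile ξ)⁻¹ * (w ξ ^ 2 + ‖gradient w ξ‖ ^ 2)) :
    Integrable w ∧ Integrable (fun ξ => w ξ ^ 2) ∧
      ∫ ξ, w ξ ^ 2 ≤ (4 * Real.pi)⁻¹ * ∫ ξ, (gaussVortexProfile ξ)⁻¹ * (w ξ ^ 2 + ‖gradient w ξ‖ ^ 2) ∧
      (∫ ξ, |w ξ|) ^ 2 ≤ ∫ ξ, (gaussVortexProfile ξ)⁻¹ * (w ξ ^ 2 + ‖gradient w ξ‖ ^ 2) := by
  have hS0 : ∀ ξ, 0 ≤ (gaussVortexProfile ξ)⁻¹ * (w ξ ^ 2 + ‖gradient w ξ‖ ^ 2) := fun ξ =>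
    mul_nonneg (inv_nonneg.2 (gaussVortexProfile_pos ξ).le) (by positivity)
  have hkey : ∀ ξ, w ξ ^ 2 ≤ gaussVortexProfile ξ * ((gaussVortexProfile ξ)⁻¹ * (w ξ ^ 2 + ‖gradient w ξ‖ ^ 2)) := by
    intro ξ
    have hG := gaussVortexProfile_pos ξ
    calc w ξ ^ 2 = gaussVortexProfile ξ * ((gaussVortexProfile ξ)⁻¹ * w ξ ^ 2) := by field_simp
      _ ≤ gaussVortexProfile ξ * ((gaussVortexProfile ξ)⁻¹ * (w ξ ^ 2 + ‖gradient w ξ‖ ^ 2)) := by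
          gcongr
          exact le_add_of_nonneg_right (sq_nonneg _)
  have hpt : ∀ ξ, w ξ ^ 2 ≤ (4 * Real.pi)⁻¹ * ((gaussVortexProfile ξ)⁻¹ * (w ξ ^ 2 + ‖gradient w ξ‖ ^ 2)) :=
    fun ξ => (hkey ξ).trans (mul_le_mul_of_nonneg_right (gaussVortexProfile_le ξ) (hS0 ξ))
  have hw2 : Integrable (fun ξ => w ξ ^ 2) :=
    (hS.const_mul _).mono' (hw.pow 2).aestronglyMeasurable (Eventually.of_forall fun ξ => by
      rw [Real.norm_of_nonneg (sq_nonneg _)]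
      exact hpt ξ)
  have hint2 : ∫ ξ, w ξ ^ 2 ≤ (4 * Real.pi)⁻¹ * ∫ ξ, (gaussVortexProfile ξ)⁻¹ * (w ξ ^ 2 + ‖gradient w ξ‖ ^ 2) := by
    rw [← integral_const_mul]
    exact integral_mono hw2 (hS.const_mul _) hpt
  have hCS := integrable_and_abs_integral_le_of_sq_le_mul (r := fun ξ => |w ξ|)
    (continuous_abs.comp hw).aestronglyMeasurable integrable_gaussVortexProfile hS
    (fun ξ => (gaussVortexProfile_pos ξ).le) hS0 (fun ξ => by rw [sq_abs]; exact hkey ξ)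
  rw [integral_gaussVortexProfile, Real.sqrt_one, one_mul] at hCS
  have hw1 : Integrable w :=
    hCS.1.mono' hw.aestronglyMeasurable (Eventually.of_forall fun ξ => le_of_eq (Real.norm_eq_abs _))
  refine ⟨hw1, hw2, hint2, ?_⟩
  calc (∫ ξ, |w ξ|) ^ 2 ≤ Real.sqrt (∫ ξ, (gaussVortexProfile ξ)⁻¹ * (w ξ ^ 2 + ‖gradient w ξ‖ ^ 2)) ^ 2 :=
        pow_le_pow_left₀ (integral_nonneg fun ξ => abs_nonneg _) ((le_abs_self _).trans hCS.2) 2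
    _ = _ := Real.sq_sqrt (integral_nonneg hS0)

/-- **The rotation form `Θ` is finite on the core class**: for `w = G u` with `u ∈ C¹`, `‖Du‖ ≤ M`,
`∂_θw = G ∂_θu` (`∂_θG = 0`) and `|∂_θu| ≤ M|ξ|`, so `G⁻¹ Ω (∂_θw)² ≤ (8π)⁻¹ M² |ξ|² G ∈ L¹`. [folklore] -/
theorem integrable_rotationForm_gaussVortexProfile_mul {u : EuclideanSpace ℝ (Fin 2) → ℝ} (hu : ContDiff ℝ 1 u)
    {M : ℝ} (h1 : ∀ x, ‖fderiv ℝ u x‖ ≤ M) :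
    Integrable fun ξ => (gaussVortexProfile ξ)⁻¹ * ((8 * Real.pi)⁻¹ * burgersPhi (‖ξ‖ ^ 2 / 4)) *
      (fderiv ℝ (fun η => gaussVortexProfile η * u η) ξ (perp ξ)) ^ 2 := by
  have hGd : ∀ ξ, HasFDerivAt gaussVortexProfile (fderiv ℝ gaussVortexProfile ξ) ξ := fun ξ =>
    ((contDiff_gaussVortexProfile (n := 1)).differentiable one_ne_zero ξ).hasFDerivAt
  have hud : ∀ ξ, HasFDerivAt u (fderiv ℝ u ξ) ξ := fun ξ => (hu.differentiable one_ne_zero ξ).hasFDerivAt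
  have hw1 : ContDiff ℝ 1 (fun η => gaussVortexProfile η * u η) := (contDiff_gaussVortexProfile (n := 1)).mul hu
  have hGu : ∀ ξ, fderiv ℝ (fun η => gaussVortexProfile η * u η) ξ (perp ξ) =
      gaussVortexProfile ξ * fderiv ℝ u ξ (perp ξ) := by
    intro ξ
    rw [((hGd ξ).fun_mul (hud ξ)).fderiv]
    simp only [FunLike.coe_add, Pi.add_apply, FunLike.coe_smul, Pi.smul_apply, smul_eq_mul,
      fderiv_gaussVortexProfile_apply, inner_self_perp, mul_zero, add_zero]
  have hc : Continuous fun ξ : EuclideanSpace ℝ (Fin 2) => (gaussVortexProfile ξ)⁻¹ *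
      ((8 * Real.pi)⁻¹ * burgersPhi (‖ξ‖ ^ 2 / 4)) *
        (fderiv ℝ (fun η => gaussVortexProfile η * u η) ξ (perp ξ)) ^ 2 :=
    (((contDiff_gaussVortexProfile (n := 0)).continuous.inv₀ fun ξ => (gaussVortexProfile_pos ξ).ne').mul
      (continuous_const.mul ((contDiff_burgersPhi (n := 0)).continuous.comp ((continuous_norm.pow 2).div_const 4)))).mul
      (((hw1.continuous_fderiv one_ne_zero).clm_apply continuous_perp).pow 2)
  refine integrable_of_le_one_add_norm_pow_mul_gauss hc (A := (8 * Real.pi)⁻¹ * M ^ 2) (N := 2) fun ξ => ?_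
  have hG := gaussVortexProfile_pos ξ
  have hφ1 : burgersPhi (‖ξ‖ ^ 2 / 4) ≤ 1 := burgersPhi_le_one (by positivity)
  have hD : |fderiv ℝ u ξ (perp ξ)| ≤ M * ‖ξ‖ := by
    rw [← Real.norm_eq_abs]
    calc ‖fderiv ℝ u ξ (perp ξ)‖ ≤ ‖fderiv ℝ u ξ‖ * ‖perp ξ‖ := ContinuousLinearMap.le_opNorm _ _
      _ ≤ M * ‖ξ‖ := by
          rw [norm_perp]
          exact mul_le_mul_of_nonneg_right (h1 ξ) (norm_nonneg _)
  have hD2 : (fderiv ℝ u ξ (perp ξ)) ^ 2 ≤ (M * ‖ξ‖) ^ 2 := sq_le_sq' (abs_le.1 hD).1 (abs_le.1 hD).2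
  rw [hGu, Real.norm_of_nonneg (mul_nonneg (mul_nonneg (inv_nonneg.2 hG.le)
    (mul_nonneg (by positivity) (burgersPhi_pos _).le)) (sq_nonneg _))]
  calc (gaussVortexProfile ξ)⁻¹ * ((8 * Real.pi)⁻¹ * burgersPhi (‖ξ‖ ^ 2 / 4)) *
        (gaussVortexProfile ξ * fderiv ℝ u ξ (perp ξ)) ^ 2
      = (8 * Real.pi)⁻¹ * burgersPhi (‖ξ‖ ^ 2 / 4) * gaussVortexProfile ξ * (fderiv ℝ u ξ (perp ξ)) ^ 2 := by
        field_simp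
    _ ≤ (8 * Real.pi)⁻¹ * 1 * gaussVortexProfile ξ * (M * ‖ξ‖) ^ 2 := by gcongr
    _ = (8 * Real.pi)⁻¹ * M ^ 2 * (‖ξ‖ ^ 2 * gaussVortexProfile ξ) := by ring
    _ ≤ (8 * Real.pi)⁻¹ * M ^ 2 * ((1 + ‖ξ‖) ^ 2 * gaussVortexProfile ξ) := by
        gcongr
        nlinarith [norm_nonneg ξ]

/-- Measurability of the pairings `G⁻¹ ⟪F, V⟫ ∂_θw` (`F` measurable, `V` continuous, `w ∈ C¹`). [folklore] -/
theorem aestronglyMeasurable_weightedPairing {F V : EuclideanSpace ℝ (Fin 2) → EuclideanSpace ℝ (Fin 2)}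
    {w : EuclideanSpace ℝ (Fin 2) → ℝ} (hF : AEStronglyMeasurable F volume) (hV : Continuous V)
    (hw : ContDiff ℝ 1 w) :
    AEStronglyMeasurable (fun ξ => (gaussVortexProfile ξ)⁻¹ * ⟪F ξ, V ξ⟫ * fderiv ℝ w ξ (perp ξ)) volume :=
  (((contDiff_gaussVortexProfile (n := 0)).continuous.inv₀ fun ξ =>
    (gaussVortexProfile_pos ξ).ne').aestronglyMeasurable.mul (hF.inner hV.aestronglyMeasurable)).mul
      ((hw.continuous_fderiv one_ne_zero).clm_apply continuous_perp).aestronglyMeasurable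

/-! ### The two pieces of `⟨Λ_B w, ∂_θw⟩_X` -/

/-- **The piece `⟪K∗w_B, ∇w⟫`**: there is `c = c(k, C_B) ≥ 0` such that for every continuous `w_B` with
`|w_B| ≤ C_B(1+|ξ|)^k G` and every `w ∈ C¹ ∩ Y` with `Θ < ∞`,
`|∫ G⁻¹ ⟪K∗w_B, ∇w⟫ ∂_θw| ≤ c ‖w‖_Y Θ^{1/2}` (far-field bound `‖K∗w_B‖ ≤ C_kC_B/(1+|ξ|)` against
`Ω⁻¹ ≤ 8π(1+|ξ|)²`, then Cauchy–Schwarz). [folklore] -/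
theorem lamB_dtheta_velocity_piece (k : ℕ) (C_B : ℝ) :
    ∃ c : ℝ, 0 ≤ c ∧ ∀ wB w : EuclideanSpace ℝ (Fin 2) → ℝ, Continuous wB →
      (∀ η, |wB η| ≤ C_B * (1 + ‖η‖) ^ k * gaussVortexProfile η) → ContDiff ℝ 1 w →
      Integrable (fun ξ => (gaussVortexProfile ξ)⁻¹ * (w ξ ^ 2 + ‖gradient w ξ‖ ^ 2)) →
      Integrable (fun ξ => (gaussVortexProfile ξ)⁻¹ * ((8 * Real.pi)⁻¹ * burgersPhi (‖ξ‖ ^ 2 / 4)) *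
        (fderiv ℝ w ξ (perp ξ)) ^ 2) →
      Integrable (fun ξ => (gaussVortexProfile ξ)⁻¹ * ⟪biotSavart2D wB ξ, gradient w ξ⟫ * fderiv ℝ w ξ (perp ξ)) ∧
        |∫ ξ, (gaussVortexProfile ξ)⁻¹ * ⟪biotSavart2D wB ξ, gradient w ξ⟫ * fderiv ℝ w ξ (perp ξ)| ≤
          c * Real.sqrt (∫ ξ, (gaussVortexProfile ξ)⁻¹ * (w ξ ^ 2 + ‖gradient w ξ‖ ^ 2)) *
            Real.sqrt (∫ ξ, (gaussVortexProfile ξ)⁻¹ * ((8 * Real.pi)⁻¹ * burgersPhi (‖ξ‖ ^ 2 / 4)) *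
              (fderiv ℝ w ξ (perp ξ)) ^ 2) := by
  obtain ⟨C_F, -, hCF⟩ := biotSavart2D_farField k
  refine ⟨Real.sqrt (8 * Real.pi * (C_F * C_B) ^ 2), Real.sqrt_nonneg _, ?_⟩
  intro wB w hwBc hwBbd hw hS hq
  have hK : ∀ ξ, ‖biotSavart2D wB ξ‖ ≤ C_F * C_B / (1 + ‖ξ‖) := fun ξ => (hCF C_B wB hwBc hwBbd ξ).1
  have hrm := aestronglyMeasurable_weightedPairing (stronglyMeasurable_biotSavart2D hwBc.measurable).aestronglyMeasurable
    ((InnerProductSpace.toDual ℝ (EuclideanSpace ℝ (Fin 2))).symm.continuous.comp (hw.continuous_fderiv one_ne_zero)) hw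
  -- Cauchy–Schwarz with `P₂ = 8π C_F² C_B² G⁻¹(w² + |∇w|²)`
  have hCS := integrable_and_abs_integral_le_of_sq_le_mul hrm (hS.const_mul (8 * Real.pi * (C_F * C_B) ^ 2)) hq
    (fun ξ => mul_nonneg (by positivity)
      (mul_nonneg (inv_nonneg.2 (gaussVortexProfile_pos ξ).le) (by positivity)))
    (fun ξ => mul_nonneg (mul_nonneg (inv_nonneg.2 (gaussVortexProfile_pos ξ).le)
      (mul_nonneg (by positivity) (burgersPhi_pos _).le)) (sq_nonneg _))
    (fun ξ => by
      have hG := gaussVortexProfile_pos ξ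
      have hΩ0 : 0 < (8 * Real.pi)⁻¹ * burgersPhi (‖ξ‖ ^ 2 / 4) := mul_pos (by positivity) (burgersPhi_pos _)
      have hr : 0 < 1 + ‖ξ‖ := by positivity
      have h1 : |⟪biotSavart2D wB ξ, gradient w ξ⟫| * (1 + ‖ξ‖) ≤ C_F * C_B * ‖gradient w ξ‖ := by
        calc |⟪biotSavart2D wB ξ, gradient w ξ⟫| * (1 + ‖ξ‖)
            ≤ C_F * C_B / (1 + ‖ξ‖) * ‖gradient w ξ‖ * (1 + ‖ξ‖) :=
              mul_le_mul_of_nonneg_right ((abs_real_inner_le_norm _ _).trans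
                (mul_le_mul_of_nonneg_right (hK ξ) (norm_nonneg _))) hr.le
          _ = C_F * C_B * ‖gradient w ξ‖ := by field_simp
      have h2 : (⟪biotSavart2D wB ξ, gradient w ξ⟫ * (1 + ‖ξ‖)) ^ 2 ≤ (C_F * C_B * ‖gradient w ξ‖) ^ 2 := by
        have := pow_le_pow_left₀ (by positivity) h1 2
        rwa [mul_pow, sq_abs, ← mul_pow] at this
      have h3 : ⟪biotSavart2D wB ξ, gradient w ξ⟫ ^ 2 ≤
          8 * Real.pi * (C_F * C_B) ^ 2 * (w ξ ^ 2 + ‖gradient w ξ‖ ^ 2) *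
            ((8 * Real.pi)⁻¹ * burgersPhi (‖ξ‖ ^ 2 / 4)) := by
        nlinarith [mul_nonneg (sq_nonneg ⟪biotSavart2D wB ξ, gradient w ξ⟫)
          (sub_nonneg.2 (one_le_mul_sq_mul_omegaWeight ξ)),
          mul_nonneg (mul_nonneg (by positivity : (0 : ℝ) ≤ 8 * Real.pi) hΩ0.le) (sub_nonneg.2 h2),
          mul_nonneg (mul_nonneg (by positivity : (0 : ℝ) ≤ 8 * Real.pi) hΩ0.le) (sq_nonneg (C_F * C_B * w ξ))]
      refine sq_weightedPairing_le (inv_nonneg.2 hG.le) ((mul_le_mul_of_nonneg_left h3 (inv_nonneg.2 hG.le)).trans ?_)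
      exact le_of_eq (by ring))
  rw [integral_const_mul, Real.sqrt_mul (by positivity)] at hCS
  exact hCS

/-- **The piece `⟪K∗w, ∇w_B⟫`**: there is `c = c(k, C_B) ≥ 0` such that for every `w_B` with continuous gradient,
`|∇w_B| ≤ C_B(1+|ξ|)^k G`, and every `w ∈ C¹ ∩ Y` with `Θ < ∞`,
`|∫ G⁻¹ ⟪K∗w, ∇w_B⟫ ∂_θw| ≤ c ‖w‖_Y Θ^{1/2}` (Young-type bound for `∫ ‖K∗w‖² h²`, `h² = 8πC_B²(1+|ξ|)^{2k+2}G`,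
then Cauchy–Schwarz). [folklore] -/
theorem lamB_dtheta_gradient_piece (k : ℕ) (C_B : ℝ) :
    ∃ c : ℝ, 0 ≤ c ∧ ∀ wB w : EuclideanSpace ℝ (Fin 2) → ℝ, Continuous (gradient wB) →
      (∀ ξ, ‖gradient wB ξ‖ ≤ C_B * (1 + ‖ξ‖) ^ k * gaussVortexProfile ξ) → ContDiff ℝ 1 w →
      Integrable (fun ξ => (gaussVortexProfile ξ)⁻¹ * (w ξ ^ 2 + ‖gradient w ξ‖ ^ 2)) →
      Integrable (fun ξ => (gaussVortexProfile ξ)⁻¹ * ((8 * Real.pi)⁻¹ * burgersPhi (‖ξ‖ ^ 2 / 4)) *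
        (fderiv ℝ w ξ (perp ξ)) ^ 2) →
      Integrable (fun ξ => (gaussVortexProfile ξ)⁻¹ * ⟪biotSavart2D w ξ, gradient wB ξ⟫ * fderiv ℝ w ξ (perp ξ)) ∧
        |∫ ξ, (gaussVortexProfile ξ)⁻¹ * ⟪biotSavart2D w ξ, gradient wB ξ⟫ * fderiv ℝ w ξ (perp ξ)| ≤
          c * Real.sqrt (∫ ξ, (gaussVortexProfile ξ)⁻¹ * (w ξ ^ 2 + ‖gradient w ξ‖ ^ 2)) *
            Real.sqrt (∫ ξ, (gaussVortexProfile ξ)⁻¹ * ((8 * Real.pi)⁻¹ * burgersPhi (‖ξ‖ ^ 2 / 4)) *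
              (fderiv ℝ w ξ (perp ξ)) ^ 2) := by
  obtain ⟨C_Y, hCY0, hCY⟩ := biotSavart2D_mul_sq_integral_le
  obtain ⟨B, hB0, hB⟩ := exists_bound_one_add_norm_pow_mul_gaussVortexProfile (2 * k + 2)
  set M' : ℝ := ∫ η : EuclideanSpace ℝ (Fin 2), (1 + ‖η‖) ^ (2 * k + 2) * gaussVortexProfile η with hM'
  have hM'0 : 0 ≤ M' := integral_nonneg fun η => mul_nonneg (by positivity) (gaussVortexProfile_pos η).le
  have hc₀0 : 0 ≤ C_Y * (8 * Real.pi * C_B ^ 2 * B * (4 * Real.pi)⁻¹ + 8 * Real.pi * C_B ^ 2 * M') := by positivity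
  refine ⟨Real.sqrt (C_Y * (8 * Real.pi * C_B ^ 2 * B * (4 * Real.pi)⁻¹ + 8 * Real.pi * C_B ^ 2 * M')),
    Real.sqrt_nonneg _, ?_⟩
  intro wB w hgwB hwB1 hw hS hq
  obtain ⟨hwi, hw2i, hw2le, hw1le⟩ := integrable_and_sq_le_of_gwSobolev hw.continuous hS
  -- the Gaussian weight `h`, `h² = 8π C_B² (1+|ξ|)^{2k+2} G`
  set h : EuclideanSpace ℝ (Fin 2) → ℝ :=
    fun ξ => Real.sqrt (8 * Real.pi * C_B ^ 2 * ((1 + ‖ξ‖) ^ (2 * k + 2) * gaussVortexProfile ξ)) with hh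
  have hh2 : ∀ ξ, h ξ ^ 2 = 8 * Real.pi * C_B ^ 2 * ((1 + ‖ξ‖) ^ (2 * k + 2) * gaussVortexProfile ξ) :=
    fun ξ => Real.sq_sqrt (mul_nonneg (by positivity) (mul_nonneg (by positivity) (gaussVortexProfile_pos ξ).le))
  have hh2f : (fun ξ => h ξ ^ 2) = fun ξ => 8 * Real.pi * C_B ^ 2 * ((1 + ‖ξ‖) ^ (2 * k + 2) * gaussVortexProfile ξ) :=
    funext hh2
  have hhc : Continuous h :=
    Real.continuous_sqrt.comp (continuous_const.mul (((continuous_const.add continuous_norm).pow _).mul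
      (contDiff_gaussVortexProfile (n := 0)).continuous))
  have hhH : ∀ ξ, |h ξ| ≤ Real.sqrt (8 * Real.pi * C_B ^ 2 * B) := fun ξ => by
    rw [abs_of_nonneg (Real.sqrt_nonneg _)]
    exact Real.sqrt_le_sqrt (mul_le_mul_of_nonneg_left (hB ξ) (by positivity))
  have hh2i : Integrable (fun ξ => h ξ ^ 2) := by
    rw [hh2f]
    exact (integrable_one_add_norm_pow_mul_gaussVortexProfile _).const_mul _
  -- the Young-type bound, `∫ ‖K∗w‖² h² ≤ c₀ ‖w‖²_Y`
  obtain ⟨hpi, hple⟩ := hCY w h (Real.sqrt (8 * Real.pi * C_B ^ 2 * B)) hw.continuous hwi hw2i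
    hhc.aestronglyMeasurable hhH hh2i
  rw [Real.sq_sqrt (by positivity), hh2f, integral_const_mul] at hple
  have hp_le : ∫ ξ, ‖biotSavart2D w ξ‖ ^ 2 * h ξ ^ 2 ≤
      C_Y * (8 * Real.pi * C_B ^ 2 * B * (4 * Real.pi)⁻¹ + 8 * Real.pi * C_B ^ 2 * M') *
        ∫ ξ, (gaussVortexProfile ξ)⁻¹ * (w ξ ^ 2 + ‖gradient w ξ‖ ^ 2) := by
    have e1 := mul_le_mul_of_nonneg_left hw2le (by positivity : (0 : ℝ) ≤ C_Y * (8 * Real.pi * C_B ^ 2 * B))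
    have e2 := mul_le_mul_of_nonneg_left hw1le (by positivity : (0 : ℝ) ≤ C_Y * (8 * Real.pi * C_B ^ 2 * M'))
    nlinarith [e1, e2]
  have hrm := aestronglyMeasurable_weightedPairing
    (stronglyMeasurable_biotSavart2D hw.continuous.measurable).aestronglyMeasurable hgwB hw
  -- Cauchy–Schwarz with `P₁ = ‖K∗w‖² h²`
  have hCS := integrable_and_abs_integral_le_of_sq_le_mul hrm hpi hq
    (fun ξ => mul_nonneg (sq_nonneg _) (sq_nonneg _))
    (fun ξ => mul_nonneg (mul_nonneg (inv_nonneg.2 (gaussVortexProfile_pos ξ).le)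
      (mul_nonneg (by positivity) (burgersPhi_pos _).le)) (sq_nonneg _))
    (fun ξ => by
      have hG := gaussVortexProfile_pos ξ
      have hX : |⟪biotSavart2D w ξ, gradient wB ξ⟫| ≤
          ‖biotSavart2D w ξ‖ * (C_B * (1 + ‖ξ‖) ^ k * gaussVortexProfile ξ) :=
        (abs_real_inner_le_norm _ _).trans (mul_le_mul_of_nonneg_left (hwB1 ξ) (norm_nonneg _))
      have hX2 : ⟪biotSavart2D w ξ, gradient wB ξ⟫ ^ 2 ≤
          (‖biotSavart2D w ξ‖ * (C_B * (1 + ‖ξ‖) ^ k * gaussVortexProfile ξ)) ^ 2 := by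
        have := pow_le_pow_left₀ (abs_nonneg _) hX 2
        rwa [sq_abs] at this
      refine sq_weightedPairing_le (inv_nonneg.2 hG.le) ?_
      calc (gaussVortexProfile ξ)⁻¹ * ⟪biotSavart2D w ξ, gradient wB ξ⟫ ^ 2
          ≤ (gaussVortexProfile ξ)⁻¹ * (‖biotSavart2D w ξ‖ * (C_B * (1 + ‖ξ‖) ^ k * gaussVortexProfile ξ)) ^ 2 :=
            mul_le_mul_of_nonneg_left hX2 (inv_nonneg.2 hG.le)
        _ = ‖biotSavart2D w ξ‖ ^ 2 * C_B ^ 2 * (1 + ‖ξ‖) ^ (2 * k) * gaussVortexProfile ξ := by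
            field_simp
            ring
        _ ≤ ‖biotSavart2D w ξ‖ ^ 2 * C_B ^ 2 * (1 + ‖ξ‖) ^ (2 * k) * gaussVortexProfile ξ *
              (8 * Real.pi * (1 + ‖ξ‖) ^ 2 * ((8 * Real.pi)⁻¹ * burgersPhi (‖ξ‖ ^ 2 / 4))) :=
            le_mul_of_one_le_right (mul_nonneg (by positivity) hG.le) (one_le_mul_sq_mul_omegaWeight ξ)
        _ = ‖biotSavart2D w ξ‖ ^ 2 * h ξ ^ 2 * ((8 * Real.pi)⁻¹ * burgersPhi (‖ξ‖ ^ 2 / 4)) := by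
            rw [hh2]
            ring)
  refine ⟨hCS.1, hCS.2.trans ?_⟩
  rw [← Real.sqrt_mul hc₀0]
  exact mul_le_mul_of_nonneg_right (Real.sqrt_le_sqrt hp_le) (Real.sqrt_nonneg _)

/-! ### The registered helper -/

/-- W4-I (H10b, background pairing against `∂_θw`): `|⟨Λ_B w, ∂_θw⟩_{L²(G⁻¹)}| ≤ C₄ ‖w‖_Y Θ^{1/2}`, `C₄ = C₄(k, C_B)`. -/
theorem lamB_pairing_dtheta_bound :
    ∀ (k : ℕ) (C_B : ℝ), ∃ C₄ : ℝ, 0 < C₄ ∧ ∀ (wB u : EuclideanSpace ℝ (Fin 2) → ℝ),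
      ContDiff ℝ 2 wB → (∀ ξ, |wB ξ| + ‖gradient wB ξ‖ ≤ C_B * (1 + ‖ξ‖) ^ k * gaussVortexProfile ξ) →
      ContDiff ℝ 2 u → (∃ M : ℝ, ∀ ξ, |u ξ| ≤ M ∧ ‖fderiv ℝ u ξ‖ ≤ M ∧ ‖fderiv ℝ (fderiv ℝ u) ξ‖ ≤ M) →
      let w : EuclideanSpace ℝ (Fin 2) → ℝ := fun η => gaussVortexProfile η * u η
      |∫ ξ, (gaussVortexProfile ξ)⁻¹ *
          (⟪biotSavart2D w ξ, gradient wB ξ⟫ + ⟪biotSavart2D wB ξ, gradient w ξ⟫) * fderiv ℝ w ξ (perp ξ)| ≤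
        C₄ * Real.sqrt (∫ ξ, (gaussVortexProfile ξ)⁻¹ * (w ξ ^ 2 + ‖gradient w ξ‖ ^ 2)) *
          Real.sqrt (∫ ξ, (gaussVortexProfile ξ)⁻¹ * ((8 * Real.pi)⁻¹ * burgersPhi (‖ξ‖ ^ 2 / 4)) *
            (fderiv ℝ w ξ (perp ξ)) ^ 2) := by
  intro k C_B
  obtain ⟨c₁, hc₁, h₁⟩ := lamB_dtheta_gradient_piece k C_B
  obtain ⟨c₂, hc₂, h₂⟩ := lamB_dtheta_velocity_piece k C_B
  refine ⟨c₁ + c₂ + 1, by positivity, ?_⟩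
  intro wB u hwB hwBbd hu hM w
  -- the background
  have hwB1 : ContDiff ℝ 1 wB := hwB.of_le one_le_two
  have hgwBc : Continuous (gradient wB) :=
    (InnerProductSpace.toDual ℝ (EuclideanSpace ℝ (Fin 2))).symm.continuous.comp (hwB1.continuous_fderiv one_ne_zero)
  have hwB0 : ∀ η, |wB η| ≤ C_B * (1 + ‖η‖) ^ k * gaussVortexProfile η := fun η =>
    (le_add_of_nonneg_right (norm_nonneg _)).trans (hwBbd η)
  have hwBg : ∀ η, ‖gradient wB η‖ ≤ C_B * (1 + ‖η‖) ^ k * gaussVortexProfile η := fun η =>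
    (le_add_of_nonneg_left (abs_nonneg _)).trans (hwBbd η)
  -- the core class: `w ∈ Y`, `Θ < ∞`
  obtain ⟨M, hM⟩ := hM
  have hu1 : ContDiff ℝ 1 u := hu.of_le one_le_two
  have hw1 : ContDiff ℝ 1 w := (contDiff_gaussVortexProfile (n := 1)).mul hu1
  have hS : Integrable (fun ξ => (gaussVortexProfile ξ)⁻¹ * (w ξ ^ 2 + ‖gradient w ξ‖ ^ 2)) :=
    (memGWSobolev_gaussVortexProfile_mul hu1 (fun x => (hM x).1) fun x => (hM x).2.1).2
  have hq : Integrable (fun ξ => (gaussVortexProfile ξ)⁻¹ * ((8 * Real.pi)⁻¹ * burgersPhi (‖ξ‖ ^ 2 / 4)) *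
      (fderiv ℝ w ξ (perp ξ)) ^ 2) :=
    integrable_rotationForm_gaussVortexProfile_mul hu1 fun x => (hM x).2.1
  obtain ⟨hi₁, hb₁⟩ := h₁ wB w hgwBc hwBg hw1 hS hq
  obtain ⟨hi₂, hb₂⟩ := h₂ wB w hwB.continuous hwB0 hw1 hS hq
  -- `|∫ (r₁ + r₂)| ≤ |∫ r₁| + |∫ r₂| ≤ (c₁ + c₂) ‖w‖_Y Θ^{1/2}`
  have key : ∀ s t : ℝ, 0 ≤ s → 0 ≤ t → c₁ * s * t + c₂ * s * t ≤ (c₁ + c₂ + 1) * s * t :=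
    fun s t hs ht => by nlinarith [mul_nonneg hs ht]
  have hfin := (abs_add_le _ _).trans ((add_le_add hb₁ hb₂).trans
    (key _ _ (Real.sqrt_nonneg _) (Real.sqrt_nonneg _)))
  rw [← integral_add hi₁ hi₂] at hfin
  refine (le_of_eq ?_).trans hfin
  congr 1
  exact integral_congr_ae (Eventually.of_forall fun ξ => by ring)

end Summit.AnomalousDissipation.AnomalousDissipation.Theorems.MarginalStabilityChainStretchedVortexRows

end
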